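import Summits.CriticalPhenomena.PercolationContinuityZ3.Theorems.SahiMasterFamilyBernsteinPos

/-!
# Conjecture (B) for every pair of union-closed families satisfying the DISJOINT-UNION CONDITION (`A ∈ 𝒰, B ∈ 𝒱, A ∩ B = ∅ ⇒ A ∪ B ∈ 𝒰 ∪ 𝒱`),
# every order — in particular whenever `𝒰 ∪ 𝒱` is union-closed: every nested edge `[1_𝒰, 1_𝒱]` (`𝒰 ⊆ 𝒱`), every pair of UP-SETS, rays and
# segments: the edge polynomial `w ↦ Φ_{n+1}(w·1_𝒰 + (1−w)·1_𝒱)` is a nonnegative combination of Bernstein monomials `w^p (1−w)^q`, `p + q ≤ n+1`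

Unit `prim-masterthm-p4` (gen 22; crux anchor stmt-CriticalPhenomena-4575, helper work; memo
`run/shared/lean/prim/prim-masterthm/prim-masterthm-p4/P4-GEN22-REPORT.md` §2).  Companion of `…BernsteinPos` (`BPos`, the block expansion
and the cap identity for every real set function, mixtures `mix`, pull-backs `comap`), `…UCBernstein` (patchwork decomposition, typed
conjecture (B) `UCBernsteinNonneg`: the degree-`k` Bernstein coefficients = layer sums `N_j` of the mixture polynomial of union-closed
families are `≥ 0`) and `…PhiSegment` / `…PhiScale` / `…PhiMinClosed` / `…EdgeStar` (POINTWISE `Φ ≥ 0` on segments, rays, min-closed points,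
free-index edges).

**THEOREM (every order)** `bpos_phiSet_mix_of_disjointUnion`: let `𝒰, 𝒱` be union-closed families of subsets of `Fin (n+1)` (no top condition)
such that `A ∈ 𝒰`, `B ∈ 𝒱`, `A ∩ B = ∅` imply `A ∪ B ∈ 𝒰 ∪ 𝒱` (the DISJOINT-UNION CONDITION; it holds whenever `𝒰 ∪ 𝒱` is union-closed, e.g. for
nested pairs and for pairs of up-sets).  Then the edge polynomial `P(w) = Φ_{n+1}(S ↦ w·[S ∈ 𝒰] + (1−w)·[S ∈ 𝒱])` is `BPos (n+1)`: identically in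
`w ∈ ℝ` a combination `Σ_i a_i w^{p_i}(1−w)^{q_i}`, `a_i ≥ 0`, `p_i + q_i ≤ n+1` — i.e. all its degree-`(n+1)` Bernstein coefficients, the layer sums
of conjecture (B) for the pair, are `≥ 0`: **(B) holds for every such pair** (`bpos_phiSet_mix_of_unionClosed_union`, `…_of_nested`, `…_of_upper`,
`bpos_phiSet_ray`, `bpos_phiSet_segment`; `phiSet_mix_nonneg_of_disjointUnion`: pointwise on `[0,1]`).
SIZE (memo §1, exact, 4 points): of the 374 550 ordered orbit-pairs of distinct union-closed families `∋ univ`, 282 282 (75.4 %) satisfy the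
disjoint-union condition (269 198 have a union-closed union, 48 737 are nested).  For the pairs with union-closed union pointwise positivity was
known (such mixtures are MIN-CLOSED, `…PhiMinClosed`); among the 13 084 further pairs none is min-closed and 2 406 lie outside every earlier
pointwise stratum (intersecting variation `…PhiAffine`, common element `…EdgeStar`), so there even `(UC-hull)` is new; coefficientwise, the
previously proved two-family classes of (B) were one family (V), the outer layers `N_1, N_n` (`…PatchSingle`) and `|𝒰 Δ 𝒱| = 2` (`…EdgeTwo`).

PROOF (memo §2).  By `BernsteinPos.phiSet_eq_sum_blocks_last` / `sum_blocks_coRest_eq_W`, for every real `β`: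
`Φ(β) = W(β) − k!(1−β_univ) + Σ_{B ∋ last, B ≠ univ} (|B|−1)!(1−β_B)·Φ(β|_{Bᶜ})`, `W(β) = Σ_{σ ∈ S_k} ∏_{c ∈ cyc σ} (1 − β_c)`.  Along a
two-family mixture every factor `1 − β_S ∈ {0, w, 1−w, 1}` is Bernstein-positive of degree `1`, `W` has degree `≤ k`, and the restricted points
are mixtures of the pulled-back pair, which inherits the hypothesis (strong induction over pairs of ALL four top types).  If `univ ∈ 𝒰 ∩ 𝒱` the
middle term vanishes; if `univ ∈ 𝒱 ∖ 𝒰`, relabel (`PhiCert.phiSet_actV`) so that the last index lies in no member of `𝒰`, then `β_B = (1−w)[B ∈ 𝒱]`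
on the last star and `Φ = (1−w)·(W + Σ_{B ∋ last, B ∉ 𝒱} (|B|−1)!·Φ(β|_{Bᶜ}))`; `univ ∈ 𝒰 ∖ 𝒱` is the mirror image; if `univ ∉ 𝒰 ∪ 𝒱` then
`Φ ≡ 0` (`phiSet_mix_eq_zero_of_disjointUnion`): in the block expansion along any index a block `B` with `β_B ≠ 0` lies in `𝒰 ∪ 𝒱`, and then its
complement lies in neither family (else `univ ∈ 𝒰 ∪ 𝒱` by union-closure or by the disjoint-union condition), so the complementary factor vanishes
by induction.  WHY THE HYPOTHESIS IS SHARP FOR THE METHOD: in general a restricted pair `(𝒰|_Q, 𝒱|_Q)` with `Q ∉ 𝒰 ∪ 𝒱` has edge polynomial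
`−Σ_{R ⊔ R' = Q, R∈𝒰, R'∈𝒱} Φ_R(w1_𝒰)Φ_{R'}((1−w)1_𝒱) ≤ 0` (memo §1, sign law) — nonzero exactly when the condition fails inside `Q`.  DATA: such pairs
are not termwise positive (single patchworks `< 0` already for nested pairs on 4 points), so the theorem is genuinely about layer sums.
HONEST FRAMING: a structural all-order theorem; conjecture (B) for general pairs, `UCHullNonneg k` (k ≥ 8), Sahi's `C_k`, Kahn's Conjecture 5 and
the master theorem remain OPEN.  Axioms standard. [this work]
-/

noncomputable section

open scoped Classical

namespace Summit.CriticalPhenomena.PercolationContinuityZ3.Theorems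

namespace UCBernsteinNested

open Finset Function Equiv
open Literature.Combinatorics.Sahi2008
open Literature.Combinatorics.Sahi2008.CycleForm
open PrincipalCapBeta (phiSet realF realW)
open BernsteinPos

variable {n : ℕ}

/-! ### Defect factors and `W` for an arbitrary pair -/

/-- Every defect factor `1 − β_S ∈ {0, w, 1−w, 1}` of a two-family mixture is Bernstein-positive of degree `1`. [this work] -/
theorem bpos_one_sub_mix' (𝒰 𝒱 : Finset (Finset (Fin n))) (S : Finset (Fin n)) :
    BPos 1 (fun w => 1 - mix 𝒰 𝒱 w S) := by
  unfold mix
  by_cases hU : S ∈ 𝒰 <;> by_cases hV : S ∈ 𝒱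
  · exact (bpos_zero.mono (Nat.zero_le 1)).congr fun w => by rw [if_pos hU, if_pos hV]; ring
  · exact bpos_one_sub.congr fun w => by rw [if_pos hU, if_neg hV]; ring
  · exact bpos_id.congr fun w => by rw [if_neg hU, if_pos hV]; ring
  · exact (bpos_const zero_le_one).congr fun w => by rw [if_neg hU, if_neg hV]; ring

/-- `W(β) = Σ_σ ∏_{c ∈ cyc σ} (1 − β_c)` is Bernstein-positive of degree `k` along any two-family mixture on `Fin (k+1)`. [this work] -/
theorem bpos_W' {k : ℕ} (𝒰 𝒱 : Finset (Finset (Fin (k + 1)))) :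
    BPos k (fun w => ∑ σ : Perm (Fin k), ∏ B ∈ orbits σ, (1 - mix 𝒰 𝒱 w (B.map Fin.castSuccEmb))) := by
  refine BPos.sum univ (fun σ w => ∏ B ∈ orbits σ, (1 - mix 𝒰 𝒱 w (B.map Fin.castSuccEmb))) fun σ _ => ?_
  exact (BPos.prod (orbits σ) (fun B w => 1 - mix 𝒰 𝒱 w (B.map Fin.castSuccEmb))
    fun B _ => bpos_one_sub_mix' 𝒰 𝒱 _).mono (card_orbits_le σ)

/-- Pull-back commutes with unions of families. [this work] -/
theorem comap_union {m : ℕ} (e : Fin m ↪ Fin n) (𝒰 𝒱 : Finset (Finset (Fin n))) :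
    comap e (𝒰 ∪ 𝒱) = comap e 𝒰 ∪ comap e 𝒱 := by
  ext S
  rw [mem_union, mem_comap, mem_comap, mem_comap, mem_union]

/-- The mirror symmetry of the edge: `mix 𝒱 𝒰 (1−w) = mix 𝒰 𝒱 w`. [this work] -/
theorem mix_swap (𝒰 𝒱 : Finset (Finset (Fin n))) (w : ℝ) : mix 𝒱 𝒰 (1 - w) = mix 𝒰 𝒱 w := by
  funext S; unfold mix; ring

/-- The disjoint-union condition is inherited by pull-backs along embeddings. [this work] -/
theorem comap_disjointUnion {m : ℕ} (e : Fin m ↪ Fin n) (𝒰 𝒱 : Finset (Finset (Fin n)))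
    (hD : ∀ A ∈ 𝒰, ∀ B ∈ 𝒱, Disjoint A B → A ∪ B ∈ 𝒰 ∪ 𝒱) :
    ∀ A ∈ comap e 𝒰, ∀ B ∈ comap e 𝒱, Disjoint A B → A ∪ B ∈ comap e 𝒰 ∪ comap e 𝒱 := by
  intro A hA B hB hAB
  rw [← comap_union, mem_comap, Finset.map_union]
  exact hD _ ((mem_comap e 𝒰 A).1 hA) _ ((mem_comap e 𝒱 B).1 hB) ((disjoint_map e).2 hAB)

/-- The disjoint-union condition is symmetric in the two families. [this work] -/
theorem disjointUnion_symm {𝒰 𝒱 : Finset (Finset (Fin n))} (hD : ∀ A ∈ 𝒰, ∀ B ∈ 𝒱, Disjoint A B → A ∪ B ∈ 𝒰 ∪ 𝒱) :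
    ∀ A ∈ 𝒱, ∀ B ∈ 𝒰, Disjoint A B → A ∪ B ∈ 𝒱 ∪ 𝒰 := by
  intro A hA B hB hAB
  rw [union_comm A B, union_comm 𝒱 𝒰]
  exact hD B hB A hA hAB.symm

/-- A union-closed union satisfies the disjoint-union condition. [this work] -/
theorem disjointUnion_of_unionClosed_union {𝒰 𝒱 : Finset (Finset (Fin n))} (hH : ∀ A ∈ 𝒰 ∪ 𝒱, ∀ B ∈ 𝒰 ∪ 𝒱, A ∪ B ∈ 𝒰 ∪ 𝒱) :
    ∀ A ∈ 𝒰, ∀ B ∈ 𝒱, Disjoint A B → A ∪ B ∈ 𝒰 ∪ 𝒱 :=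
  fun A hA B hB _ => hH A (mem_union_left _ hA) B (mem_union_right _ hB)

/-- The complementary embedding of `exists_emb_coRest`, with its range recorded: every index outside `B` is hit. [this work] -/
theorem exists_emb_coRest' {k : ℕ} {B : Finset (Fin (k + 1))} (hBu : B ≠ univ) :
    ∃ (n : ℕ) (e : Fin (n + 1) ↪ Fin (k + 1)), (∀ j, e j ∉ B) ∧ (∀ x, x ∉ B → ∃ j, e j = x) ∧
      ∀ β : Finset (Fin (k + 1)) → ℝ, coRest (realW β) realF B = -phiSet (n + 1) (fun S => β (S.map e)) := by
  obtain ⟨y, hy⟩ : ∃ y, y ∉ B := not_forall.1 (mt eq_univ_iff_forall.2 hBu)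
  have hN : 0 < Fintype.card {x // x ∉ B} := Fintype.card_pos_iff.2 ⟨⟨y, hy⟩⟩
  obtain ⟨n, hn⟩ : ∃ n, Fintype.card {x // x ∉ B} = n + 1 := ⟨Fintype.card {x // x ∉ B} - 1, by omega⟩
  let e0 : Fin (n + 1) ≃ {x // x ∉ B} := ((Fintype.equivFin {x // x ∉ B}).trans (finCongr hn)).symm
  let e : Fin (n + 1) ↪ Fin (k + 1) := e0.toEmbedding.trans (Embedding.subtype _)
  refine ⟨n, e, fun j => (e0 j).2, fun x hx => ⟨e0.symm ⟨x, hx⟩, ?_⟩, fun β => ?_⟩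
  · show ((e0 (e0.symm ⟨x, hx⟩) : {x // x ∉ B}) : Fin (k + 1)) = x
    rw [Equiv.apply_symm_apply]
  rw [coRest_of_ne_univ _ _ hBu, ← cycleSum_comp_equiv (realW β) e0 (fun j : {x // x ∉ B} => realF (j : Fin (k + 1))),
    ← sahiE_eq_cycleSum (realW β) (Nat.succ_le_succ (Nat.zero_le n)), PrincipalCapBeta.sahiE_eq_phiSet]
  congr 2
  funext S
  have e1 : (∏ x ∈ S, realF ((e0 x : {x // x ∉ B}) : Fin (k + 1))) = ∏ x ∈ S.map e, realF x := by
    rw [prod_map]; rfl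
  rw [e1, PrincipalCapBeta.ex_realW_prod]

/-- For the embedding of `exists_emb_coRest'`, `univ.map e = univ \ B`. [this work] -/
theorem map_univ_eq_sdiff {k m : ℕ} {B : Finset (Fin (k + 1))} (e : Fin (m + 1) ↪ Fin (k + 1)) (he : ∀ j, e j ∉ B)
    (hsurj : ∀ x, x ∉ B → ∃ j, e j = x) : (univ : Finset (Fin (m + 1))).map e = univ \ B := by
  ext x
  rw [mem_map, mem_sdiff]
  constructor
  · rintro ⟨j, _, rfl⟩; exact ⟨mem_univ _, he j⟩
  · rintro ⟨_, hx⟩; obtain ⟨j, hj⟩ := hsurj x hx; exact ⟨j, mem_univ _, hj⟩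

/-! ### Doubly top-free pairs: the edge polynomial vanishes -/

/-- **Vanishing lemma.**  For union-closed `𝒰, 𝒱` satisfying the disjoint-union condition and containing `univ` in NEITHER family, the edge
polynomial is identically `0` (block expansion along the last index: a block with nonzero weight lies in `𝒰 ∪ 𝒱`, and then its complement lies
in neither family, so the complementary factor vanishes by induction). [this work] -/
theorem phiSet_mix_eq_zero_of_disjointUnion : ∀ (n : ℕ) (𝒰 𝒱 : Finset (Finset (Fin (n + 1)))),
    (∀ A ∈ 𝒰, ∀ B ∈ 𝒰, A ∪ B ∈ 𝒰) → (∀ A ∈ 𝒱, ∀ B ∈ 𝒱, A ∪ B ∈ 𝒱) →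
    (∀ A ∈ 𝒰, ∀ B ∈ 𝒱, Disjoint A B → A ∪ B ∈ 𝒰 ∪ 𝒱) → univ ∉ 𝒰 → univ ∉ 𝒱 →
      ∀ w : ℝ, phiSet (n + 1) (mix 𝒰 𝒱 w) = 0 := by
  intro n
  induction n using Nat.strong_induction_on with
  | _ n ih =>
  intro 𝒰 𝒱 hU hV hD htopU htopV w
  rw [phiSet_eq_sum_blocks_last]
  refine sum_eq_zero fun B hB => ?_
  have hlB : Fin.last n ∈ B := (mem_filter.1 hB).2
  by_cases hBUV : B ∈ 𝒰 ∨ B ∈ 𝒱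
  · -- the complement of `B` lies in neither family
    have hBu : B ≠ univ := by rintro rfl; exact hBUV.elim htopU htopV
    obtain ⟨m, e, he, hsurj, hc⟩ := exists_emb_coRest' hBu
    have hm : m < n := PhiVertex.lt_of_emb_ne_last e fun j hj => he j (by rw [hj]; exact hlB)
    have hrange := map_univ_eq_sdiff e he hsurj
    have hcomplU : univ \ B ∉ 𝒰 := by
      intro h
      rcases hBUV with hBU | hBV
      · exact htopU (by have := hU _ hBU _ h; rwa [union_sdiff_of_subset (subset_univ B)] at this)
      · by_cases hBU : B ∈ 𝒰
        · exact htopU (by have := hU _ hBU _ h; rwa [union_sdiff_of_subset (subset_univ B)] at this)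
        · have h' := hD _ h _ hBV sdiff_disjoint
          rw [sdiff_union_of_subset (subset_univ B)] at h'
          exact (mem_union.1 h').elim htopU htopV
    have hcomplV : univ \ B ∉ 𝒱 := by
      intro h
      rcases hBUV with hBU | hBV
      · by_cases hBV : B ∈ 𝒱
        · exact htopV (by have := hV _ hBV _ h; rwa [union_sdiff_of_subset (subset_univ B)] at this)
        · have h' := hD _ hBU _ h disjoint_sdiff
          rw [union_sdiff_of_subset (subset_univ B)] at h'
          exact (mem_union.1 h').elim htopU htopV
      · exact htopV (by have := hV _ hBV _ h; rwa [union_sdiff_of_subset (subset_univ B)] at this)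
    have htopU' : univ ∉ comap e 𝒰 := by rw [mem_comap, hrange]; exact hcomplU
    have htopV' : univ ∉ comap e 𝒱 := by rw [mem_comap, hrange]; exact hcomplV
    have hz := ih m hm (comap e 𝒰) (comap e 𝒱) (comap_unionClosed e 𝒰 hU) (comap_unionClosed e 𝒱 hV)
      (comap_disjointUnion e 𝒰 𝒱 hD) htopU' htopV' w
    rw [hc, mix_map, hz, neg_zero, mul_zero, mul_zero]
  · -- zero weight on the block
    have h0 : mix 𝒰 𝒱 w B = 0 := by
      unfold mix
      rw [if_neg (fun h => hBUV (Or.inl h)), if_neg (fun h => hBUV (Or.inr h))]; ring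
    rw [h0, zero_mul, mul_zero]

/-! ### The theorem -/

/-- **Root-last step.**  Assume the theorem below order `n+1`.  A pair `𝒰, 𝒱` of union-closed families on `Fin (n+1)` with the disjoint-union
condition has a Bernstein-positive edge polynomial as soon as `univ ∈ 𝒰 ∩ 𝒱`, or `univ ∈ 𝒱` and no member of `𝒰` contains the last index.
[this work] -/
theorem bpos_mix_rootLast (n : ℕ)
    (ih : ∀ m < n, ∀ (𝒰 𝒱 : Finset (Finset (Fin (m + 1)))), (∀ A ∈ 𝒰, ∀ B ∈ 𝒰, A ∪ B ∈ 𝒰) →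
      (∀ A ∈ 𝒱, ∀ B ∈ 𝒱, A ∪ B ∈ 𝒱) → (∀ A ∈ 𝒰, ∀ B ∈ 𝒱, Disjoint A B → A ∪ B ∈ 𝒰 ∪ 𝒱) →
      BPos (m + 1) (fun w => phiSet (m + 1) (mix 𝒰 𝒱 w)))
    (𝒰 𝒱 : Finset (Finset (Fin (n + 1)))) (hU : ∀ A ∈ 𝒰, ∀ B ∈ 𝒰, A ∪ B ∈ 𝒰)
    (hV : ∀ A ∈ 𝒱, ∀ B ∈ 𝒱, A ∪ B ∈ 𝒱) (hD : ∀ A ∈ 𝒰, ∀ B ∈ 𝒱, Disjoint A B → A ∪ B ∈ 𝒰 ∪ 𝒱)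
    (hroot : (univ ∈ 𝒰 ∧ univ ∈ 𝒱) ∨ (univ ∈ 𝒱 ∧ ∀ S ∈ 𝒰, Fin.last n ∉ S)) :
    BPos (n + 1) (fun w => phiSet (n + 1) (mix 𝒰 𝒱 w)) := by
  -- the restricted functionals along blocks through the last index are edge polynomials of the pulled-back pair, one order down
  have hsub : ∀ B : Finset (Fin (n + 1)), Fin.last n ∈ B → B ≠ univ →
      BPos n (fun w => -coRest (realW (mix 𝒰 𝒱 w)) realF B) := by
    intro B hB hBu
    obtain ⟨m, e, he, hc⟩ := exists_emb_coRest hBu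
    have hm : m < n := PhiVertex.lt_of_emb_ne_last e fun j hj => he j (by rw [hj]; exact hB)
    have ihB := ih m hm (comap e 𝒰) (comap e 𝒱) (comap_unionClosed e 𝒰 hU) (comap_unionClosed e 𝒱 hV)
      (comap_disjointUnion e 𝒰 𝒱 hD)
    refine (ihB.mono (by omega)).congr fun w => ?_
    rw [hc, mix_map, neg_neg]
  rcases hroot with ⟨htopU, htopV⟩ | ⟨htopV, havoid⟩
  · -- `univ ∈ 𝒰 ∩ 𝒱`: `Φ = W + Σ_{B ∋ last} (|B|−1)!·(1−β_B)·(−κ_B)`, the `B = univ` term vanishing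
    have hW := (bpos_W' (k := n) 𝒰 𝒱).mono (Nat.le_succ n)
    have hterms : BPos (n + 1) (fun w => ∑ B ∈ univ.filter (fun B : Finset (Fin (n + 1)) => Fin.last n ∈ B),
        ((B.card - 1).factorial : ℝ) * ((1 - mix 𝒰 𝒱 w B) * (-coRest (realW (mix 𝒰 𝒱 w)) realF B))) := by
      refine BPos.sum _ (fun B w => ((B.card - 1).factorial : ℝ) *
        ((1 - mix 𝒰 𝒱 w B) * (-coRest (realW (mix 𝒰 𝒱 w)) realF B))) fun B hB => ?_
      have hlB : Fin.last n ∈ B := (mem_filter.1 hB).2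
      by_cases hBu : B = univ
      · refine bpos_zero.congr fun w => ?_
        have h1 : mix 𝒰 𝒱 w B = 1 := by
          rw [hBu]; unfold mix; rw [if_pos htopU, if_pos htopV]; ring
        simp only [h1, sub_self, zero_mul, mul_zero]
      · exact (((bpos_one_sub_mix' 𝒰 𝒱 B).mul (hsub B hlB hBu)).smul (Nat.cast_nonneg _)).mono (by omega)
    refine (hW.add hterms).congr fun w => ?_
    exact (phiSet_eq_W_add_sum (mix 𝒰 𝒱 w)).symm
  · -- `univ ∈ 𝒱`, last index in no member of `𝒰`: `Φ = (1−w)·(W + Σ_{B ∋ last, B ∉ 𝒱} (|B|−1)!·(−κ_B))`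
    have hW := bpos_W' (k := n) 𝒰 𝒱
    have hterms : BPos n (fun w => ∑ B ∈ univ.filter (fun B : Finset (Fin (n + 1)) => Fin.last n ∈ B),
        ((B.card - 1).factorial : ℝ) * ((1 - (if B ∈ 𝒱 then (1 : ℝ) else 0)) *
          (-coRest (realW (mix 𝒰 𝒱 w)) realF B))) := by
      refine BPos.sum _ (fun B w => ((B.card - 1).factorial : ℝ) * ((1 - (if B ∈ 𝒱 then (1 : ℝ) else 0)) *
          (-coRest (realW (mix 𝒰 𝒱 w)) realF B))) fun B hB => ?_
      have hlB : Fin.last n ∈ B := (mem_filter.1 hB).2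
      by_cases hBV : B ∈ 𝒱
      · exact bpos_zero.congr fun w => by rw [if_pos hBV]; ring
      · have hBu : B ≠ univ := fun h => hBV (by rw [h]; exact htopV)
        exact ((hsub B hlB hBu).smul (Nat.cast_nonneg _)).congr fun w => by rw [if_neg hBV]; ring
    refine ((bpos_one_sub.mul (hW.add hterms)).mono (by omega)).congr fun w => ?_
    rw [phiSet_eq_sum_blocks_last, ← sum_blocks_coRest_eq_W (mix 𝒰 𝒱 w), ← sum_add_distrib, mul_sum]
    refine sum_congr rfl fun B hB => ?_
    have hlB : Fin.last n ∈ B := (mem_filter.1 hB).2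
    have hBU : B ∉ 𝒰 := fun h => havoid B h hlB
    have e1 : mix 𝒰 𝒱 w B = (1 - w) * (if B ∈ 𝒱 then (1 : ℝ) else 0) := by
      unfold mix; rw [if_neg hBU]; ring
    rw [e1]
    ring

/-- The relabelling used below: if `t` lies in no member of `𝒲`, the last index lies in no member of the pull-back of `𝒲` along the
transposition `(t last)`. [this work] -/
theorem last_notMem_of_comap_swap (t : Fin (n + 1)) (𝒲 : Finset (Finset (Fin (n + 1)))) (ht : ∀ S ∈ 𝒲, t ∉ S) :
    ∀ S ∈ comap (Equiv.swap t (Fin.last n)).toEmbedding 𝒲, Fin.last n ∉ S := by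
  intro S hS hl
  rw [mem_comap] at hS
  refine ht _ hS (mem_map.2 ⟨Fin.last n, hl, ?_⟩)
  show Equiv.swap t (Fin.last n) (Fin.last n) = t
  exact Equiv.swap_apply_right _ _

/-- **Step with `univ ∈ 𝒱`** (assuming the theorem below order `n+1`): relabel so that the last index is avoided by `𝒰` when
`univ ∉ 𝒰`. [this work] -/
theorem bpos_mix_of_topV (n : ℕ)
    (ih : ∀ m < n, ∀ (𝒰 𝒱 : Finset (Finset (Fin (m + 1)))), (∀ A ∈ 𝒰, ∀ B ∈ 𝒰, A ∪ B ∈ 𝒰) →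
      (∀ A ∈ 𝒱, ∀ B ∈ 𝒱, A ∪ B ∈ 𝒱) → (∀ A ∈ 𝒰, ∀ B ∈ 𝒱, Disjoint A B → A ∪ B ∈ 𝒰 ∪ 𝒱) →
      BPos (m + 1) (fun w => phiSet (m + 1) (mix 𝒰 𝒱 w)))
    (𝒰 𝒱 : Finset (Finset (Fin (n + 1)))) (hU : ∀ A ∈ 𝒰, ∀ B ∈ 𝒰, A ∪ B ∈ 𝒰)
    (hV : ∀ A ∈ 𝒱, ∀ B ∈ 𝒱, A ∪ B ∈ 𝒱) (hD : ∀ A ∈ 𝒰, ∀ B ∈ 𝒱, Disjoint A B → A ∪ B ∈ 𝒰 ∪ 𝒱) (htopV : univ ∈ 𝒱) :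
    BPos (n + 1) (fun w => phiSet (n + 1) (mix 𝒰 𝒱 w)) := by
  by_cases htopU : univ ∈ 𝒰
  · exact bpos_mix_rootLast n ih 𝒰 𝒱 hU hV hD (Or.inl ⟨htopU, htopV⟩)
  · obtain ⟨t, ht⟩ := PhiSegment.exists_forall_notMem 𝒰 hU htopU
    let σ : Perm (Fin (n + 1)) := Equiv.swap t (Fin.last n)
    have htopV' : univ ∈ comap σ.toEmbedding 𝒱 := by
      rw [mem_comap, Finset.map_univ_equiv]; exact htopV
    have h := bpos_mix_rootLast n ih (comap σ.toEmbedding 𝒰) (comap σ.toEmbedding 𝒱)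
      (comap_unionClosed _ 𝒰 hU) (comap_unionClosed _ 𝒱 hV) (comap_disjointUnion _ 𝒰 𝒱 hD)
      (Or.inr ⟨htopV', last_notMem_of_comap_swap t 𝒰 ht⟩)
    exact h.congr fun w => phiSet_mix_comap_perm σ 𝒰 𝒱 w

/-- **THEOREM ((B) for pairs with the disjoint-union condition, every order).**  For union-closed families `𝒰, 𝒱` of subsets of `Fin (n+1)`
(no top condition) such that `A ∈ 𝒰, B ∈ 𝒱, A ∩ B = ∅ ⇒ A ∪ B ∈ 𝒰 ∪ 𝒱`, the edge polynomial `w ↦ Φ_{n+1}(w·1_𝒰 + (1−w)·1_𝒱)` is a nonnegative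
combination of Bernstein monomials `w^p(1−w)^q`, `p + q ≤ n+1`. [this work] -/
theorem bpos_phiSet_mix_of_disjointUnion : ∀ (n : ℕ) (𝒰 𝒱 : Finset (Finset (Fin (n + 1)))),
    (∀ A ∈ 𝒰, ∀ B ∈ 𝒰, A ∪ B ∈ 𝒰) → (∀ A ∈ 𝒱, ∀ B ∈ 𝒱, A ∪ B ∈ 𝒱) →
    (∀ A ∈ 𝒰, ∀ B ∈ 𝒱, Disjoint A B → A ∪ B ∈ 𝒰 ∪ 𝒱) →
      BPos (n + 1) (fun w => phiSet (n + 1) (mix 𝒰 𝒱 w)) := by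
  intro n
  induction n using Nat.strong_induction_on with
  | _ n ih =>
  intro 𝒰 𝒱 hU hV hD
  by_cases htopV : univ ∈ 𝒱
  · exact bpos_mix_of_topV n ih 𝒰 𝒱 hU hV hD htopV
  · by_cases htopU : univ ∈ 𝒰
    · -- mirror image: `mix 𝒰 𝒱 w = mix 𝒱 𝒰 (1 − w)`
      have ih' : ∀ m < n, ∀ (𝒰 𝒱 : Finset (Finset (Fin (m + 1)))), (∀ A ∈ 𝒰, ∀ B ∈ 𝒰, A ∪ B ∈ 𝒰) →
          (∀ A ∈ 𝒱, ∀ B ∈ 𝒱, A ∪ B ∈ 𝒱) → (∀ A ∈ 𝒰, ∀ B ∈ 𝒱, Disjoint A B → A ∪ B ∈ 𝒰 ∪ 𝒱) →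
          BPos (m + 1) (fun w => phiSet (m + 1) (mix 𝒰 𝒱 w)) := ih
      have h := (bpos_mix_of_topV n ih' 𝒱 𝒰 hV hU (disjointUnion_symm hD) htopU).reflect
      exact h.congr fun w => by rw [mix_swap]
    · -- `univ ∉ 𝒰 ∪ 𝒱`: the edge polynomial vanishes identically
      exact bpos_zero.congr fun w => (phiSet_mix_eq_zero_of_disjointUnion n 𝒰 𝒱 hU hV hD htopU htopV w).symm

/-! ### Corollaries: union-closed unions, nested pairs, up-sets, rays, segments, pointwise positivity -/

/-- **(B) for pairs with union-closed union**, every order. [this work] -/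
theorem bpos_phiSet_mix_of_unionClosed_union (n : ℕ) (𝒰 𝒱 : Finset (Finset (Fin (n + 1))))
    (hU : ∀ A ∈ 𝒰, ∀ B ∈ 𝒰, A ∪ B ∈ 𝒰) (hV : ∀ A ∈ 𝒱, ∀ B ∈ 𝒱, A ∪ B ∈ 𝒱)
    (hH : ∀ A ∈ 𝒰 ∪ 𝒱, ∀ B ∈ 𝒰 ∪ 𝒱, A ∪ B ∈ 𝒰 ∪ 𝒱) :
    BPos (n + 1) (fun w => phiSet (n + 1) (mix 𝒰 𝒱 w)) :=
  bpos_phiSet_mix_of_disjointUnion n 𝒰 𝒱 hU hV (disjointUnion_of_unionClosed_union hH)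

/-- **(B) on every nested edge**: union-closed `𝒰 ⊆ 𝒱` (no top condition), every order. [this work] -/
theorem bpos_phiSet_mix_of_nested (𝒰 𝒱 : Finset (Finset (Fin (n + 1)))) (hU : ∀ A ∈ 𝒰, ∀ B ∈ 𝒰, A ∪ B ∈ 𝒰)
    (hV : ∀ A ∈ 𝒱, ∀ B ∈ 𝒱, A ∪ B ∈ 𝒱) (hUV : 𝒰 ⊆ 𝒱) :
    BPos (n + 1) (fun w => phiSet (n + 1) (mix 𝒰 𝒱 w)) := by
  refine bpos_phiSet_mix_of_unionClosed_union n 𝒰 𝒱 hU hV ?_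
  rw [union_eq_right.2 hUV]
  exact hV

/-- **(B) for every pair of up-sets** (families closed under supersets; their union is an up-set, and up-sets are union-closed), every
order. [this work] -/
theorem bpos_phiSet_mix_of_upper (𝒰 𝒱 : Finset (Finset (Fin (n + 1))))
    (hU : ∀ A ∈ 𝒰, ∀ B : Finset (Fin (n + 1)), A ⊆ B → B ∈ 𝒰) (hV : ∀ A ∈ 𝒱, ∀ B : Finset (Fin (n + 1)), A ⊆ B → B ∈ 𝒱) :
    BPos (n + 1) (fun w => phiSet (n + 1) (mix 𝒰 𝒱 w)) := by
  refine bpos_phiSet_mix_of_unionClosed_union n 𝒰 𝒱 (fun A hA B _ => hU A hA _ subset_union_left)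
    (fun A hA B _ => hV A hA _ subset_union_left) fun A hA B _ => ?_
  rcases mem_union.1 hA with h | h
  · exact mem_union_left _ (hU A h _ subset_union_left)
  · exact mem_union_right _ (hV A h _ subset_union_left)

/-- **Ray polynomials are Bernstein-positive**: `w ↦ Φ_{n+1}(w·1_𝒱)` for every union-closed `𝒱`, every order. [this work] -/
theorem bpos_phiSet_ray (𝒱 : Finset (Finset (Fin (n + 1)))) (hV : ∀ A ∈ 𝒱, ∀ B ∈ 𝒱, A ∪ B ∈ 𝒱) :
    BPos (n + 1) (fun w => phiSet (n + 1) (fun S => w * (if S ∈ 𝒱 then (1 : ℝ) else 0))) := by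
  have h := (bpos_phiSet_mix_of_nested ∅ 𝒱 (fun A hA => absurd hA (notMem_empty A)) hV (empty_subset _)).reflect
  refine h.congr fun w => ?_
  congr 1
  funext S
  unfold mix
  rw [if_neg (notMem_empty S)]
  ring

/-- **Segment polynomials are Bernstein-positive**: `v ↦ Φ_{n+1}(1_𝒰 + v·1_{𝒰ᶜ})` for every union-closed `𝒰`, every order
(the polynomial form of `PhiSegment.phiSet_segment_nonneg`). [this work] -/
theorem bpos_phiSet_segment (𝒰 : Finset (Finset (Fin (n + 1)))) (hU : ∀ A ∈ 𝒰, ∀ B ∈ 𝒰, A ∪ B ∈ 𝒰) :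
    BPos (n + 1) (fun v => phiSet (n + 1) (fun S => if S ∈ 𝒰 then (1 : ℝ) else v)) := by
  have h := (bpos_phiSet_mix_of_nested 𝒰 univ hU (fun A _ B _ => mem_univ _) (subset_univ _)).reflect
  refine h.congr fun v => ?_
  congr 1
  funext S
  unfold mix
  rw [if_pos (mem_univ S)]
  by_cases hS : S ∈ 𝒰
  · simp only [if_pos hS]; ring
  · simp only [if_neg hS]; ring

/-- Pointwise: `Φ_{n+1}(w·1_𝒰 + (1−w)·1_𝒱) ≥ 0` on `[0,1]` for union-closed `𝒰, 𝒱` with the disjoint-union condition — `(UC-hull)` on all these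
edges, every order (new beyond the min-closed / intersecting / common-element strata for 2 406 orbit-pairs on 4 points). [this work] -/
theorem phiSet_mix_nonneg_of_disjointUnion (𝒰 𝒱 : Finset (Finset (Fin (n + 1)))) (hU : ∀ A ∈ 𝒰, ∀ B ∈ 𝒰, A ∪ B ∈ 𝒰)
    (hV : ∀ A ∈ 𝒱, ∀ B ∈ 𝒱, A ∪ B ∈ 𝒱) (hD : ∀ A ∈ 𝒰, ∀ B ∈ 𝒱, Disjoint A B → A ∪ B ∈ 𝒰 ∪ 𝒱)
    {w : ℝ} (hw0 : 0 ≤ w) (hw1 : w ≤ 1) : 0 ≤ phiSet (n + 1) (mix 𝒰 𝒱 w) :=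
  (bpos_phiSet_mix_of_disjointUnion n 𝒰 𝒱 hU hV hD).nonneg hw0 hw1

/-- Pointwise, union-closed union (a second proof of the min-closed case of `…PhiMinClosed` for these mixtures). [this work] -/
theorem phiSet_mix_nonneg_of_unionClosed_union (𝒰 𝒱 : Finset (Finset (Fin (n + 1)))) (hU : ∀ A ∈ 𝒰, ∀ B ∈ 𝒰, A ∪ B ∈ 𝒰)
    (hV : ∀ A ∈ 𝒱, ∀ B ∈ 𝒱, A ∪ B ∈ 𝒱) (hH : ∀ A ∈ 𝒰 ∪ 𝒱, ∀ B ∈ 𝒰 ∪ 𝒱, A ∪ B ∈ 𝒰 ∪ 𝒱)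
    {w : ℝ} (hw0 : 0 ≤ w) (hw1 : w ≤ 1) : 0 ≤ phiSet (n + 1) (mix 𝒰 𝒱 w) :=
  (bpos_phiSet_mix_of_unionClosed_union n 𝒰 𝒱 hU hV hH).nonneg hw0 hw1

end UCBernsteinNested

end Summit.CriticalPhenomena.PercolationContinuityZ3.Theorems
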